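import Summits.AtomisticToContinuum.FouriersLaw.Theorems.BondHeatUncertaintyExtensiveSnapshotIrreversibilityEnergyWindowHarmonicLinearisation
import Literature.MathematicalPhysics.KineticTheory.LangevinChainKernelDensity
import HarnessLib

/-!
# Bond–heat uncertainty window, part U-c: costate sampling of the harmonic skeleton Jacobian

Cell `decomp-a2c`, lineage crux `ExtensiveSnapshotIrreversibility` (K_fix half, leaf S3
`KernelTemperatureLipschitz`), HARMONIC CALIBRATION of (SWM) `SkeletonWeightMoments` (part R),
step 3 of 4.  For the harmonic chain `pinnedChain ω₂ 0 0 γ` the level-`m` skeleton Jacobian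
`w_j(s) = D_x E^s(x)[b_j]` (the variational solution of `LangevinChainVariational` forced by the
`j`-th dyadic tent of a bath) is deterministic, and its pairing with a covector `λ` is an explicit
CELL AVERAGE of the bath-momentum component of the harmonic costate `c_λ(t) = exp((t-s)𝒢)λ`
(part U-b):

* §1 `⟨λ, w(s)⟩ = Σ_i λ.2 i h_i(s) - ∫₀ˢ Σ_i (𝒢 c_λ(t)).2 i h_i(t) dt` for a momentum forcing
  `(0, h)` (`harmonic_dualPair_variation`; differentiate `⟨c_λ, w - (0,h)⟩`, fundamental theorem of
  calculus on `[0, s]` — the costate is globally smooth, so no one-sided derivatives are needed);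
* §2 for the tent forcing of the FULL dyadic cell `I_k = [k 2^{-m}, (k+1) 2^{-m}] ⊆ [0, s]` of bath
  `b` with amplitude `amp`: `⟨λ, w_k(s)⟩ = amp · 2^m ∫_{I_k} (c_λ(t)).2 b dt`
  (`harmonic_dualPair_variation_cell`; integration by parts against the tent,
  `integral_deriv_mul_rtent` of `LangevinChainCostate.lean`), instantiated for the two baths of the
  skeleton forcing `skelForcing` (`…_inl`: left bath, amplitude `ampL = √(2γT_L)`, site `0`;
  `…_inr`: right bath, `ampR`, site `N-1`, with the mirror `skelForcing_single_snd` of the tree's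
  `skelForcing_single_fst`);
* §3 the Riemann-sum lower bound: with `β = (c_λ).2 b`, `L` a Lipschitz and `B` a sup bound of `β`
  on `[0, s]`, `Σ_{k < ⌊s 2^m⌋} 2^m (∫_{I_k} β)² ≥ ½ ∫₀ˢ β² - (L² 4^{-m} + B²) 2^{-m}`-type
  (`sum_sq_cellIntegral_ge`), the only analysis behind `Γ_m ≳ Gramian - O(2^{-m})`.

No new instance / notation; no proof holes.  References: E. D. Sontag, *Mathematical Control
Theory* (1998), §3.5 (adjoint representation of reachability); D. Nualart, *The Malliavin Calculus
and Related Topics* (2006), §2.3.1 (the Malliavin matrix of a linear SDE is the controllability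
Gramian).
-/

noncomputable section

namespace Summit.AtomisticToContinuum.FouriersLaw.Theorems.ExtensiveSnapshotIrreversibility.EnergyWindow

open MeasureTheory Filter Topology Real unitInterval Set NormedSpace
open scoped ContDiff NNReal
open Literature.MathematicalPhysics.KineticTheory.HeatConduction
open Literature.Probability.Process Literature.Analysis.ODE

/-! ## 1. The harmonic costate representation at time `s` -/

section Pairing

variable {ω₂ γ : ℝ} (hω : 0 < ω₂) (hγ : 0 ≤ γ) (N : ℕ)

/-- Continuity of `t ↦ Σ_i (𝒢 c_λ(t)).2 i h_i(t)`. [folklore] -/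
theorem continuous_harmCostate_deriv_sum (s : ℝ) (l : PhaseSpace N) {h : ℝ → Fin N → ℝ}
    (hh : Continuous h) :
    Continuous fun t =>
      ∑ i, (harmCoDriftLin ω₂ γ N (harmCostate ω₂ γ N s l t)).2 i * h t i := by
  refine continuous_finsetSum _ fun i _ => ?_
  exact ((continuous_apply i).comp (continuous_snd.comp
    ((harmCoDriftLin ω₂ γ N).continuous.comp (continuous_harmCostate ω₂ γ N s l)))).mul
    ((continuous_apply i).comp hh)

include hω hγ

/-- **Harmonic costate representation (momentum forcing, time `s`).** If the variational solution
`w` of the harmonic chain is forced by the momentum path `(0, h)` (`H δ = h` on `[0, 1]`), then for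
`s ∈ [0, 1]` and every covector `λ`,
`⟨λ, w(s)⟩ = Σ_i λ.2 i h_i(s) - ∫₀ˢ Σ_i (𝒢 c_λ(t)).2 i h_i(t) dt`, `c_λ(t) = exp((t-s)𝒢) λ`.
[folklore] -/
theorem harmonic_dualPair_variation {X : Type} [NormedAddCommGroup X] [NormedSpace ℝ X]
    [CompleteSpace X] (z : PhaseSpace N) {η₀ : ℝ → Fin N → ℝ} (hη₀ : Continuous η₀)
    (H : X →L[ℝ] C(I, Fin N → ℝ)) (x δ : X) {h : ℝ → Fin N → ℝ}
    (hH : ∀ τ : I, (H δ τ : Fin N → ℝ) = h τ) {s : ℝ} (hs : s ∈ Icc (0 : ℝ) 1) (l : PhaseSpace N) :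
    dualPair l (pinnedChainVariation hω le_rfl le_rfl hγ N z hη₀ H x δ s) =
      ∑ i, l.2 i * h s i -
        ∫ t in (0 : ℝ)..s, ∑ i, (harmCoDriftLin ω₂ γ N (harmCostate ω₂ γ N s l t)).2 i * h t i := by
  set w := pinnedChainVariation hω le_rfl le_rfl hγ N z hη₀ H x δ with hw_def
  have hwc : Continuous w := continuous_pinnedChainVariation hω le_rfl le_rfl hγ N z hη₀ H x δ
  have hsol := harmonic_isIntegralSolutionOn_variation hω hγ N z hη₀ H x δ
  set u : ℝ → PhaseSpace N := fun τ => ∫ r in (0 : ℝ)..τ, harmDriftLin ω₂ γ N (w r) with hu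
  have hg : Continuous fun r => harmDriftLin ω₂ γ N (w r) :=
    (harmDriftLin ω₂ γ N).continuous.comp hwc
  have hud : ∀ τ, HasDerivAt u (harmDriftLin ω₂ γ N (w τ)) τ := fun τ =>
    (hg.integral_hasStrictDerivAt 0 τ).hasDerivAt
  have huc : Continuous u := continuous_iff_continuousAt.2 fun τ => (hud τ).continuousAt
  have hwu : ∀ τ ∈ Icc (0 : ℝ) 1, w τ = u τ + ((0 : Fin N → ℝ), h τ) := by
    intro τ hτ
    have h1 : w τ = (((0 : Fin N → ℝ), IccExtend zero_le_one (H δ) τ) : PhaseSpace N) +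
        ∫ r in (0 : ℝ)..τ, harmDriftLin ω₂ γ N (w r) := hsol τ hτ
    rw [IccExtend_of_mem _ _ hτ, hH ⟨τ, hτ⟩] at h1
    show w τ = (∫ r in (0 : ℝ)..τ, harmDriftLin ω₂ γ N (w r)) + ((0 : Fin N → ℝ), h τ)
    rw [h1, add_comm]
  set c := harmCostate ω₂ γ N s l with hc_def
  set F : ℝ → ℝ := fun t => dualPair (c t) (u t) with hF
  set F' : ℝ → ℝ := fun t => dualPair (harmCoDriftLin ω₂ γ N (c t)) (u t) +
    dualPair (c t) (harmDriftLin ω₂ γ N (w t)) with hF'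
  have hFd : ∀ t, HasDerivAt F (F' t) t := fun t =>
    hasDerivAt_dualPair (hasDerivAt_harmCostate ω₂ γ N s l t) (hud t)
  have hval : ∀ t ∈ Icc (0 : ℝ) 1,
      F' t = -∑ i, (harmCoDriftLin ω₂ γ N (c t)).2 i * h t i := by
    intro t ht
    rw [hF']
    change dualPair (harmCoDriftLin ω₂ γ N (c t)) (u t) +
      dualPair (c t) (harmDriftLin ω₂ γ N (w t)) = _
    rw [dualPair_harmCoDriftLin, hwu t ht, map_add, dualPair_add_right, neg_add_cancel_left]
    have h2 := (pinnedChain ω₂ 0 0 γ).dualPair_fderiv_drift_zero_mk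
      (pinnedChain_contDiff_U ω₂ 0 0 γ)
      (pinnedChain_contDiff_V ω₂ 0 0 γ) N 0 (c t) (h t)
    rw [show harmDriftLin ω₂ γ N = fderiv ℝ ((pinnedChain ω₂ 0 0 γ).drift N) 0 from rfl, h2]
    rfl
  have hF'c : Continuous F' := by
    rw [hF']
    exact (continuous_dualPair.comp
      (((harmCoDriftLin ω₂ γ N).continuous.comp (continuous_harmCostate ω₂ γ N s l)).prodMk
        huc)).add
      (continuous_dualPair.comp ((continuous_harmCostate ω₂ γ N s l).prodMk hg))
  have hFTC := intervalIntegral.integral_eq_sub_of_hasDerivAt (fun t _ => hFd t)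
    (hF'c.intervalIntegrable 0 s)
  have hF0 : F 0 = 0 := by simp [hF, hu, dualPair]
  have hFs : F s = dualPair l (w s) - ∑ i, l.2 i * h s i := by
    rw [hF]
    change dualPair (c s) (u s) = _
    rw [hc_def, harmCostate_self, eq_sub_iff_add_eq, ← dualPair_zero_mk l (h s),
      ← dualPair_add_right, ← hwu s hs]
  have hint : ∫ t in (0 : ℝ)..s, F' t =
      -∫ t in (0 : ℝ)..s, ∑ i, (harmCoDriftLin ω₂ γ N (c t)).2 i * h t i := by
    rw [← intervalIntegral.integral_neg]
    refine intervalIntegral.integral_congr fun t ht => ?_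
    rw [uIcc_of_le hs.1] at ht
    exact hval t ⟨ht.1, ht.2.trans hs.2⟩
  rw [hF0, hFs, sub_zero, hint] at hFTC
  linarith

/-- **Cell formula.** If the forcing direction `δ` is the dyadic tent `θ^m_k` of bath `b` with
amplitude `amp` (`(H δ)(τ) i = [i = b] amp θ^m_k(τ)`), then at every time `s ∈ [t_{k+1}, 1]` (the
cell is FULLY elapsed) `⟨λ, w(s)⟩ = amp · 2^m ∫_{t_k}^{t_{k+1}} (c_λ(t)).2 b dt`. [folklore] -/
theorem harmonic_dualPair_variation_cell {X : Type} [NormedAddCommGroup X] [NormedSpace ℝ X]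
    [CompleteSpace X] (z : PhaseSpace N) {η₀ : ℝ → Fin N → ℝ} (hη₀ : Continuous η₀)
    (H : X →L[ℝ] C(I, Fin N → ℝ)) (x δ : X) (b : Fin N) (amp : ℝ) {m k : ℕ} (hk : k < 2 ^ m)
    (hH : ∀ τ : I, ∀ i, H δ τ i = (if i = b then amp else 0) * rtent m k τ)
    {s : ℝ} (hks : rnode m (k + 1) ≤ s) (hs1 : s ≤ 1) (l : PhaseSpace N) :
    dualPair l (pinnedChainVariation hω le_rfl le_rfl hγ N z hη₀ H x δ s) =
      amp * 2 ^ m * ∫ t in rnode m k..rnode m (k + 1), (harmCostate ω₂ γ N s l t).2 b := by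
  have hs0 : 0 ≤ s := (rnode_succ_pos m k).le.trans hks
  have hH' : ∀ τ : I, (H δ τ : Fin N → ℝ) =
      fun i : Fin N => (if i = b then amp else 0) * rtent m k τ := fun τ => funext (hH τ)
  rw [harmonic_dualPair_variation hω hγ N z hη₀ H x δ
    (h := fun t i => (if i = b then amp else 0) * rtent m k t) hH' ⟨hs0, hs1⟩ l]
  -- the two sums collapse on the bath component
  set β : ℝ → ℝ := fun t => (harmCostate ω₂ γ N s l t).2 b with hβ
  set β' : ℝ → ℝ := fun t => (harmCoDriftLin ω₂ γ N (harmCostate ω₂ γ N s l t)).2 b with hβ'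
  have hsum1 : ∑ i, l.2 i * ((if i = b then amp else 0) * rtent m k s) = amp * l.2 b := by
    simp [rtent_of_ge hks, mul_comm]
  have hsum2 : ∀ t, ∑ i, (harmCoDriftLin ω₂ γ N (harmCostate ω₂ γ N s l t)).2 i *
      ((if i = b then amp else 0) * rtent m k t) = amp * (β' t * rtent m k t) := by
    intro t
    simp [hβ']
    ring
  simp_rw [hsum1, hsum2]
  rw [intervalIntegral.integral_const_mul]
  -- integration by parts against the tent on `[0, 1]`, minus the part on `[s, 1]`
  have hβc : Continuous β := continuous_harmCostate_snd ω₂ γ N s l b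
  have hβ'c : Continuous β' := (continuous_apply b).comp (continuous_snd.comp
    ((harmCoDriftLin ω₂ γ N).continuous.comp (continuous_harmCostate ω₂ γ N s l)))
  have hβd : ∀ t, HasDerivAt β (β' t) t := fun t => hasDerivAt_harmCostate_snd ω₂ γ N s l b t
  have hI1 := integral_deriv_mul_rtent hβc.continuousOn hβ'c.continuousOn (fun t _ => hβd t) hk
  have hprod : Continuous fun t => β' t * rtent m k t := hβ'c.mul (continuous_rtent m k)
  have hsplit := intervalIntegral.integral_add_adjacent_intervals
    (hprod.intervalIntegrable (μ := volume) 0 s) (hprod.intervalIntegrable (μ := volume) s 1)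
  have hI2 : ∫ t in s..1, β' t * rtent m k t = β 1 - β s := by
    have h1 : ∫ t in s..1, β' t * rtent m k t = ∫ t in s..1, β' t := by
      refine intervalIntegral.integral_congr fun t ht => ?_
      rw [uIcc_of_le hs1] at ht
      simp only [rtent_of_ge (hks.trans ht.1), mul_one]
    rw [h1]
    exact intervalIntegral.integral_eq_sub_of_hasDerivAt (fun t _ => hβd t)
      (hβ'c.intervalIntegrable s 1)
  have hβs : β s = l.2 b := by
    simp only [hβ, harmCostate_self]
  have hI0 : ∫ t in (0 : ℝ)..s, β' t * rtent m k t =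
      l.2 b - 2 ^ m * ∫ t in rnode m k..rnode m (k + 1), β t := by
    rw [← hβs]
    linarith
  rw [hI0]
  ring

end Pairing

/-! ## 2. The two baths of the skeleton forcing -/

section Baths

/-- Mirror of the tree's `skelForcing_single_fst`: for the standard basis skeleton `(0, e_k)` the
forcing is the right-bath tent `(H (0, e_k)) τ i = [i = N-1] c_R λ^m_k(τ)`. [folklore] -/
theorem skelForcing_single_snd (N m : ℕ) (c_L c_R : ℝ) (k : Fin (2 ^ m)) (τ : I) (i : Fin N) :
    skelForcing N m c_L c_R ((0, Pi.single k 1) : PairSkeleton m) τ i =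
      (if i.val = N - 1 then c_R else 0) * tentCoeff m k (toNN τ) := by
  rw [skelForcing_apply]
  have h1 : plInterp m (Pi.single k (1 : ℝ)) (toNN τ) = tentCoeff m k (toNN τ) := by
    simp [plInterp, Pi.single_apply]
  have h2 : plInterp m (0 : Fin (2 ^ m) → ℝ) (toNN τ) = 0 := by simp [plInterp]
  simp only [h1, h2, mul_zero, zero_add]

/-- The left-bath tent directions of `skelForcing`: `(H b_{inl k}) τ i = [i = 0] c_L θ^m_k(τ)`.
[folklore] -/
theorem skelForcing_basisX_inl {N : ℕ} (hN : 0 < N) (m : ℕ) (c_L c_R : ℝ) (k : Fin (2 ^ m))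
    (τ : I) (i : Fin N) :
    skelForcing N m c_L c_R (basisX m (Sum.inl k)) τ i =
      (if i = ⟨0, hN⟩ then c_L else 0) * rtent m k τ := by
  change skelForcing N m c_L c_R ((Pi.single k 1, 0) : PairSkeleton m) τ i = _
  rw [skelForcing_single_fst, tentCoeff_toNN]
  congr 1
  by_cases hi : i = ⟨0, hN⟩
  · subst hi; simp
  · have : i.val ≠ 0 := fun h => hi (Fin.ext h)
    simp [hi, this]

/-- The right-bath tent directions of `skelForcing`: `(H b_{inr k}) τ i = [i = N-1] c_R θ^m_k(τ)`.
[folklore] -/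
theorem skelForcing_basisX_inr {N : ℕ} (hN : 0 < N) (m : ℕ) (c_L c_R : ℝ) (k : Fin (2 ^ m))
    (τ : I) (i : Fin N) :
    skelForcing N m c_L c_R (basisX m (Sum.inr k)) τ i =
      (if i = ⟨N - 1, by omega⟩ then c_R else 0) * rtent m k τ := by
  change skelForcing N m c_L c_R ((0, Pi.single k 1) : PairSkeleton m) τ i = _
  rw [skelForcing_single_snd, tentCoeff_toNN]
  congr 1
  by_cases hi : i = ⟨N - 1, by omega⟩
  · subst hi; simp
  · have : i.val ≠ N - 1 := fun h => hi (Fin.ext h)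
    simp [hi, this]

variable {ω₂ γ : ℝ} (hω : 0 < ω₂) (hγ : 0 ≤ γ) {N : ℕ} (hN : 0 < N) (T_L T_R : ℝ)

include hω hγ

/-- **Left-bath cells of the harmonic skeleton Jacobian**: for `t_{k+1} ≤ s ≤ 1`,
`⟨λ, w_{inl k}(s)⟩ = √(2γT_L) · 2^m ∫_{I_k} (c_λ(t)).2 0 dt`, whatever the starting point, the
remainder noise and the skeleton. [folklore] -/
theorem harmonic_dualPair_skelVariation_inl (m : ℕ) (z : PhaseSpace N) (r : WienerPair)
    (x : PairSkeleton m) (k : Fin (2 ^ m)) {s : ℝ} (hks : rnode m (k + 1) ≤ s) (hs1 : s ≤ 1)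
    (l : PhaseSpace N) :
    dualPair l (pinnedChainVariation hω le_rfl le_rfl hγ N z
        (continuous_chainNoise_rem ω₂ 0 0 γ N T_L T_R r)
        (skelForcing N m (ampL ω₂ 0 0 γ T_L) (ampR ω₂ 0 0 γ T_R)) x (basisX m (Sum.inl k)) s) =
      ampL ω₂ 0 0 γ T_L * 2 ^ m *
        ∫ t in rnode m k..rnode m (k + 1), (harmCostate ω₂ γ N s l t).2 ⟨0, hN⟩ :=
  harmonic_dualPair_variation_cell hω hγ N z _ _ x _ ⟨0, hN⟩ (ampL ω₂ 0 0 γ T_L) k.isLt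
    (fun τ i => skelForcing_basisX_inl hN m _ _ k τ i) hks hs1 l

/-- **Right-bath cells of the harmonic skeleton Jacobian**: for `t_{k+1} ≤ s ≤ 1`,
`⟨λ, w_{inr k}(s)⟩ = √(2γT_R) · 2^m ∫_{I_k} (c_λ(t)).2 (N-1) dt`. [folklore] -/
theorem harmonic_dualPair_skelVariation_inr (m : ℕ) (z : PhaseSpace N) (r : WienerPair)
    (x : PairSkeleton m) (k : Fin (2 ^ m)) {s : ℝ} (hks : rnode m (k + 1) ≤ s) (hs1 : s ≤ 1)
    (l : PhaseSpace N) :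
    dualPair l (pinnedChainVariation hω le_rfl le_rfl hγ N z
        (continuous_chainNoise_rem ω₂ 0 0 γ N T_L T_R r)
        (skelForcing N m (ampL ω₂ 0 0 γ T_L) (ampR ω₂ 0 0 γ T_R)) x (basisX m (Sum.inr k)) s) =
      ampR ω₂ 0 0 γ T_R * 2 ^ m *
        ∫ t in rnode m k..rnode m (k + 1), (harmCostate ω₂ γ N s l t).2 ⟨N - 1, by omega⟩ :=
  harmonic_dualPair_variation_cell hω hγ N z _ _ x _ ⟨N - 1, by omega⟩ (ampR ω₂ 0 0 γ T_R)
    k.isLt (fun τ i => skelForcing_basisX_inr hN m _ _ k τ i) hks hs1 l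

end Baths

end Summit.AtomisticToContinuum.FouriersLaw.Theorems.ExtensiveSnapshotIrreversibility.EnergyWindow
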